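import Literature.MathematicalPhysics.KineticTheory.HardSphereEulerProofs
import HarnessLib

/-!
# Law domination (stub A of the rung-½ refutation, line `level-census-comparison`, crux
# `EnergyCurrentTails`, stmt-AtomisticToContinuum-9235)

Bounding the temperature profile `θ₀` between `θmin > 0` and `θmax` bounds the inhomogeneous local Gibbs
law `λ_{a,u,θ₀}` of `N + 1` hard spheres (constant activity `a`, constant drift `u`) by
`((θmax/θmin)^{3/2})^{N+1}` times the HOMOGENEOUS law `λ_{a,u,θmax}`:

* pointwise, `M_{1,u,θ}(v) ≤ (θmax/θmin)^{3/2} M_{1,u,θmax}(v)` for `θmin ≤ θ ≤ θmax`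
  (`(2πθ)^{-3/2} ≤ (2πθmin)^{-3/2} = (θmax/θmin)^{3/2} (2πθmax)^{-3/2}`, and the Gaussian exponent is
  monotone in `θ`), so the tensor powers compare with the constant `K^{N+1}`;
* the canonical partition functions of the two profiles AGREE (`canonicalPartition_eq_posPartition`: the
  Maxwellian velocity factors integrate to one, leaving the configurational `Z_pos` of the activity `a`);
* `withDensity` is monotone in the density and commutes with constant multiples.
-/

noncomputable section

open MeasureTheory Set Filter
open scoped ENNReal InnerProductSpace BigOperators Classical

namespace Summit.AtomisticToContinuum.HydrodynamicLimit.Theorems.EnergyCurrentTailsRungHalf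

open Literature.MathematicalPhysics.KineticTheory Literature.Analysis.FluidPDE

-- adapted from `LedgerAssembly.exp_mul_norm_sq_mul_localMaxwellian_le`
-- (Summits/…/OneFlightGossipEngineKineticCurrentsWindowLDUniformLedgerAssemblyStatics.lean)
/-- Pointwise Maxwellian comparison: for `0 < θmin ≤ θ ≤ θmax`,
`M_{1,u,θ}(v) ≤ (θmax/θmin)^{3/2} M_{1,u,θmax}(v)` on `ℝ³`. [folklore] -/
theorem localMaxwellian_le_rpow_mul_localMaxwellian {θ θmin θmax : ℝ} (hmin : 0 < θmin)
    (h1 : θmin ≤ θ) (h2 : θ ≤ θmax) (u v : V3) :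
    localMaxwellian 1 θ u v ≤ (θmax / θmin) ^ ((3 : ℝ) / 2) * localMaxwellian 1 θmax u v := by
  have hd : (Module.finrank ℝ V3 : ℝ) = 3 := by
    rw [finrank_euclideanSpace_fin]; norm_num
  have hθ : 0 < θ := hmin.trans_le h1
  have hθmax : 0 < θmax := hθ.trans_le h2
  unfold localMaxwellian
  rw [hd, one_mul, one_mul]
  have hpre : (θmax / θmin) ^ ((3 : ℝ) / 2) * (2 * Real.pi * θmax) ^ (-(3 : ℝ) / 2) =
      (2 * Real.pi * θmin) ^ (-(3 : ℝ) / 2) := by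
    rw [neg_div, Real.rpow_neg (show (0 : ℝ) ≤ 2 * Real.pi * θmax by positivity),
      Real.rpow_neg (show (0 : ℝ) ≤ 2 * Real.pi * θmin by positivity),
      Real.div_rpow hθmax.le hmin.le, Real.mul_rpow (by positivity) hθmax.le,
      Real.mul_rpow (by positivity) hmin.le]
    have h3 : 0 < θmax ^ ((3 : ℝ) / 2) := Real.rpow_pos_of_pos hθmax _
    have h4 : 0 < θmin ^ ((3 : ℝ) / 2) := Real.rpow_pos_of_pos hmin _
    have h5 : 0 < (2 * Real.pi) ^ ((3 : ℝ) / 2) := Real.rpow_pos_of_pos (by positivity) _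
    field_simp
  have hmono : (2 * Real.pi * θ) ^ (-(3 : ℝ) / 2) ≤ (2 * Real.pi * θmin) ^ (-(3 : ℝ) / 2) :=
    Real.rpow_le_rpow_of_nonpos (by positivity)
      (mul_le_mul_of_nonneg_left h1 (by positivity)) (by norm_num)
  have hexp : Real.exp (-‖v - u‖ ^ 2 / (2 * θ)) ≤ Real.exp (-‖v - u‖ ^ 2 / (2 * θmax)) := by
    rw [Real.exp_le_exp, neg_div, neg_div, neg_le_neg_iff]
    exact div_le_div_of_nonneg_left (sq_nonneg _) (by positivity) (by linarith)
  calc (2 * Real.pi * θ) ^ (-(3 : ℝ) / 2) * Real.exp (-‖v - u‖ ^ 2 / (2 * θ))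
      ≤ (2 * Real.pi * θmin) ^ (-(3 : ℝ) / 2) * Real.exp (-‖v - u‖ ^ 2 / (2 * θmax)) :=
        mul_le_mul hmono hexp (Real.exp_pos _).le (Real.rpow_nonneg (by positivity) _)
    _ = (θmax / θmin) ^ ((3 : ℝ) / 2) *
          ((2 * Real.pi * θmax) ^ (-(3 : ℝ) / 2) * Real.exp (-‖v - u‖ ^ 2 / (2 * θmax))) := by
        rw [← hpre, mul_assoc]

/-- Pointwise comparison of the canonical densities: with `K = (θmax/θmin)^{3/2}`, the canonical density of
the profile `(a, u, θ₀)`, `θmin ≤ θ₀ ≤ θmax`, is at most `K^{N+1}` times that of the constant profile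
`(a, u, θmax)` (same hard-sphere indicator, same partition function `Z_pos`, factorwise Maxwellian
comparison). [folklore] -/
theorem canonicalDensity_le_pow_mul_canonicalDensity {a : ℝ} (u : V3) {θ₀ : T3 → ℝ} {θmin θmax : ℝ}
    (hθc : Continuous θ₀) (hmin : 0 < θmin) (hlo : ∀ x, θmin ≤ θ₀ x) (hhi : ∀ x, θ₀ x ≤ θmax)
    (ha : 0 < a) (ε : ℝ) (n : ℕ) (z : Config n (Fin 3) T3) :
    canonicalDensity (Torus.geometry (Fin 3)) ε n (localGibbsProfile (fun _ => a) (fun _ => u) θ₀) z ≤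
      ((θmax / θmin) ^ ((3 : ℝ) / 2)) ^ n *
        canonicalDensity (Torus.geometry (Fin 3)) ε n
          (localGibbsProfile (fun _ => a) (fun _ => u) (fun _ => θmax)) z := by
  have hθmax0 : 0 < θmax := (hmin.trans_le (hlo 0)).trans_le (hhi 0)
  have hθ0 : ∀ x, 0 < θ₀ x := fun x => hmin.trans_le (hlo x)
  have hZ : canonicalPartition (Torus.geometry (Fin 3)) ε n
        (localGibbsProfile (fun _ => a) (fun _ => u) θ₀) =
      canonicalPartition (Torus.geometry (Fin 3)) ε n
        (localGibbsProfile (fun _ => a) (fun _ => u) (fun _ => θmax)) := by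
    rw [canonicalPartition_eq_posPartition continuous_const hθc continuous_const (fun _ => ha.le) hθ0,
      canonicalPartition_eq_posPartition continuous_const continuous_const continuous_const
        (fun _ => ha.le) (fun _ => hθmax0)]
  have hZ0 : 0 ≤ (canonicalPartition (Torus.geometry (Fin 3)) ε n
      (localGibbsProfile (fun _ => a) (fun _ => u) (fun _ => θmax)))⁻¹ :=
    inv_nonneg.2 (canonicalPartition_nonneg _ _ _ fun y =>
      localGibbsProfile_nonneg (fun _ => ha.le) (fun _ => hθmax0.le) y)
  unfold canonicalDensity
  rw [hZ, mul_left_comm]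
  refine mul_le_mul_of_nonneg_left ?_ hZ0
  by_cases hz : z ∈ hardSphereDomain (Torus.geometry (Fin 3)) n ε
  · rw [indicator_of_mem hz, indicator_of_mem hz]
    unfold tensorPow
    calc ∏ i, localGibbsProfile (fun _ => a) (fun _ => u) θ₀ (z i)
        ≤ ∏ i, (θmax / θmin) ^ ((3 : ℝ) / 2) *
            localGibbsProfile (fun _ => a) (fun _ => u) (fun _ => θmax) (z i) := by
          refine Finset.prod_le_prod (fun i _ =>
            localGibbsProfile_nonneg (fun _ => ha.le) (fun x => (hθ0 x).le) (z i)) fun i _ => ?_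
          unfold localGibbsProfile
          rw [mul_left_comm]
          exact mul_le_mul_of_nonneg_left
            (localMaxwellian_le_rpow_mul_localMaxwellian hmin (hlo _) (hhi _) u (z i).2) ha.le
      _ = ((θmax / θmin) ^ ((3 : ℝ) / 2)) ^ n *
            ∏ i, localGibbsProfile (fun _ => a) (fun _ => u) (fun _ => θmax) (z i) := by
          rw [Finset.prod_mul_distrib, Finset.prod_const, Finset.card_univ, Fintype.card_fin]
  · rw [indicator_of_notMem hz, indicator_of_notMem hz, mul_zero]

/-- Stub A — LAW DOMINATION: bounding the temperature profile between `θmin` and `θmax` bounds the local Gibbs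
law by `((θmax/θmin)^{3/2})^{N+1}` times the homogeneous law at temperature `θmax` (same activity, same
drift): the Maxwellians compare pointwise and the partition function does not depend on the temperature
profile (`canonicalPartition_eq_posPartition`). [folklore] -/
theorem stub_lawDomination :
    ∀ (σ a : ℝ) (u : V3) (θ₀ : T3 → ℝ) (θmin θmax : ℝ), Continuous θ₀ → 0 < θmin →
      (∀ x, θmin ≤ θ₀ x) → (∀ x, θ₀ x ≤ θmax) → 0 < a →
      ∀ (N : ℕ) (Φ : HardSphereFlow (Torus.geometry (Fin 3)) (hsDiameter σ N) (N + 1)),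
        localGibbsLaw σ (fun _ => a) (fun _ => u) θ₀ N Φ ≤
          ENNReal.ofReal (((θmax / θmin) ^ ((3 : ℝ) / 2)) ^ (N + 1)) •
            localGibbsLaw σ (fun _ => a) (fun _ => u) (fun _ => θmax) N Φ := by
  intro σ a u θ₀ θmin θmax hθc hmin hlo hhi ha N Φ
  have hK0 : 0 ≤ ((θmax / θmin) ^ ((3 : ℝ) / 2)) ^ (N + 1) :=
    pow_nonneg (Real.rpow_nonneg (div_nonneg ((hmin.trans_le (hlo 0)).trans_le (hhi 0)).le hmin.le) _) _
  rw [localGibbsLaw_eq, localGibbsLaw_eq]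
  unfold localGibbsMeasure
  rw [← withDensity_smul' _ _ ENNReal.ofReal_ne_top]
  refine withDensity_mono (Eventually.of_forall fun z => ?_)
  rw [Pi.smul_apply, smul_eq_mul, ← ENNReal.ofReal_mul hK0]
  exact ENNReal.ofReal_le_ofReal
    (canonicalDensity_le_pow_mul_canonicalDensity u hθc hmin hlo hhi ha (hsDiameter σ N) (N + 1) z)

end Summit.AtomisticToContinuum.HydrodynamicLimit.Theorems.EnergyCurrentTailsRungHalf
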